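import Mathlib
import Summits.AtomisticToContinuum.Crystallization.Theorems.NashClassCertificatesNashNearFieldStubTriLandscapeTermwise

/-!
# Crux `NashNearField` (16827), stub `stub_triLandscapeNearOblique` (NEAR′): the per-term second-order DIFFERENCE bound for the tails

Near the box family the constant tail of `stub_triTruncation` cannot serve (`W` and `c·S′²` both vanish at `S′ = 0`); the tail of the
word-free functional has to be bounded as a DIFFERENCE, to second order in the strain: for a far template vector `v` with reference
squared distance `q₀ = |D′v|²` and deformed one `q = q₀ + dq`, `dq = 2ℓ_v·E + |Ev|²` (`tri_q_expand`), the term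
`G(q) − G(q₀)` (`G(q) = V_LJ(√q) = q⁻⁶/12 − q⁻³/6`) equals its first-order part `G′(q₀)·dq` — whose transverse piece cancels over
every `ρ`-invariant set (`tri_C3_firstOrder`) and whose tangential piece is charged to the outward linear rate — up to a remainder
quadratic in `dq`, uniformly `O(q₀⁻⁵)`:
* `tri_lj_T1_identity` — the EXACT first-order remainder
  `G(q) − G(q₀) − G′(q₀)(q−q₀) = (q−q₀)²·(â₁ − 2q³q₀³b̂₁)/(12q⁶q₀⁷)`,
  `â₁ = q₀⁵ + 2q₀⁴q + 3q₀³q² + 4q₀²q³ + 5q₀q⁴ + 6q⁵`, `b̂₁ = q₀² + 2q₀q + 3q²` (binomial remainders `(r−1)²Σ(m+1)rᵐ`, `r = q/q₀`);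
* `tri_lj_T1_remainder_abs_le` — for `(3/5)q₀ ≤ q ≤ (7/5)q₀`:
  `|G(q) − G(q₀) − G′(q₀)(q−q₀)| ≤ (q−q₀)²·(130·q₀⁻⁸ + 96·q₀⁻⁵)`
  (`Σ(m+1)(7/5)ᵐ = 72.13 ≤ 130·12·(3/5)⁶`, `2(7/5)³(1 + 2·7/5 + 3·(7/5)²) = 53.12 ≤ 96·12·(3/5)⁶`).
With `|dq| ≤ 2|D′v||v||E| + |v|²|E|² ≤ 0.31|v|²` and `q₀ ≥ 0.8|v|²` on the near region the hypothesis `|dq| ≤ (2/5)q₀` holds for every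
template vector, and the remainder summed over `|v|² ≥ R²` with the planar counts is `O(R⁻³)·|E|²` — the summable second-order tail
constant `C(s)` of NEAR_STATUS §6f.
-/

noncomputable section

open Literature.MathematicalPhysics.StatisticalMechanics

namespace Summit.AtomisticToContinuum.Crystallization.Theorems.NashClassCertificatesNashNearField

/-- **Exact first-order remainder of `G(q) = q⁻⁶/12 − q⁻³/6`.** [folklore] -/
theorem tri_lj_T1_identity {q q₀ : ℝ} (hq : 0 < q) (hq₀ : 0 < q₀) :
    ((1 / 12) * q⁻¹ ^ 6 - (1 / 6) * q⁻¹ ^ 3) - ((1 / 12) * q₀⁻¹ ^ 6 - (1 / 6) * q₀⁻¹ ^ 3) -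
        (-(q₀⁻¹ ^ 7) / 2 + q₀⁻¹ ^ 4 / 2) * (q - q₀) =
      (q - q₀) ^ 2 * ((q₀ ^ 5 + 2 * q₀ ^ 4 * q + 3 * q₀ ^ 3 * q ^ 2 + 4 * q₀ ^ 2 * q ^ 3 + 5 * q₀ * q ^ 4 + 6 * q ^ 5) -
        2 * q ^ 3 * q₀ ^ 3 * (q₀ ^ 2 + 2 * q₀ * q + 3 * q ^ 2)) / (12 * q ^ 6 * q₀ ^ 7) := by
  have hq' : q ≠ 0 := hq.ne'
  have hq₀' : q₀ ≠ 0 := hq₀.ne'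
  field_simp
  ring

/-- Size of the first-order remainder numerator on `q ≤ (7/5)q₀`:
`|â₁ − 2q³q₀³b̂₁| ≤ (225417/3125)·q₀⁵ + (166012/3125)·q₀⁸`. [folklore] -/
theorem tri_lj_T1_num_abs_le {q q₀ : ℝ} (hq : 0 ≤ q) (hq₀ : 0 < q₀) (hhi : q ≤ 7 / 5 * q₀) :
    |(q₀ ^ 5 + 2 * q₀ ^ 4 * q + 3 * q₀ ^ 3 * q ^ 2 + 4 * q₀ ^ 2 * q ^ 3 + 5 * q₀ * q ^ 4 + 6 * q ^ 5) -
        2 * q ^ 3 * q₀ ^ 3 * (q₀ ^ 2 + 2 * q₀ * q + 3 * q ^ 2)| ≤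
      225417 / 3125 * q₀ ^ 5 + 166012 / 3125 * q₀ ^ 8 := by
  have hm : ∀ m : ℕ, q ^ m ≤ (7 / 5) ^ m * q₀ ^ m := fun m => by
    rw [← mul_pow]; exact pow_le_pow_left₀ hq hhi m
  have hA0 : 0 ≤ q₀ ^ 5 + 2 * q₀ ^ 4 * q + 3 * q₀ ^ 3 * q ^ 2 + 4 * q₀ ^ 2 * q ^ 3 + 5 * q₀ * q ^ 4 + 6 * q ^ 5 := by positivity
  have hB0 : 0 ≤ 2 * q ^ 3 * q₀ ^ 3 * (q₀ ^ 2 + 2 * q₀ * q + 3 * q ^ 2) := by positivity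
  -- `â₁ ≤ A q₀⁵`
  have e1 := mul_le_mul_of_nonneg_left (hm 1) (by positivity : (0 : ℝ) ≤ 2 * q₀ ^ 4)
  have e2 := mul_le_mul_of_nonneg_left (hm 2) (by positivity : (0 : ℝ) ≤ 3 * q₀ ^ 3)
  have e3 := mul_le_mul_of_nonneg_left (hm 3) (by positivity : (0 : ℝ) ≤ 4 * q₀ ^ 2)
  have e4 := mul_le_mul_of_nonneg_left (hm 4) (by positivity : (0 : ℝ) ≤ 5 * q₀)
  have e5 := mul_le_mul_of_nonneg_left (hm 5) (by positivity : (0 : ℝ) ≤ 6)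
  have hA : q₀ ^ 5 + 2 * q₀ ^ 4 * q + 3 * q₀ ^ 3 * q ^ 2 + 4 * q₀ ^ 2 * q ^ 3 + 5 * q₀ * q ^ 4 + 6 * q ^ 5 ≤
      225417 / 3125 * q₀ ^ 5 := by
    have : (225417 : ℝ) / 3125 * q₀ ^ 5 = q₀ ^ 5 + 2 * q₀ ^ 4 * ((7 / 5) ^ 1 * q₀ ^ 1) + 3 * q₀ ^ 3 * ((7 / 5) ^ 2 * q₀ ^ 2) +
        4 * q₀ ^ 2 * ((7 / 5) ^ 3 * q₀ ^ 3) + 5 * q₀ * ((7 / 5) ^ 4 * q₀ ^ 4) + 6 * ((7 / 5) ^ 5 * q₀ ^ 5) := by ring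
    rw [this]; rw [pow_one, pow_one] at e1 ⊢; linarith
  -- `2q³q₀³b̂₁ ≤ B q₀⁸`
  have f3 := mul_le_mul_of_nonneg_left (hm 3) (by positivity : (0 : ℝ) ≤ 2 * q₀ ^ 5)
  have f4 := mul_le_mul_of_nonneg_left (hm 4) (by positivity : (0 : ℝ) ≤ 4 * q₀ ^ 4)
  have f5 := mul_le_mul_of_nonneg_left (hm 5) (by positivity : (0 : ℝ) ≤ 6 * q₀ ^ 3)
  have hB : 2 * q ^ 3 * q₀ ^ 3 * (q₀ ^ 2 + 2 * q₀ * q + 3 * q ^ 2) ≤ 166012 / 3125 * q₀ ^ 8 := by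
    have e : 2 * q ^ 3 * q₀ ^ 3 * (q₀ ^ 2 + 2 * q₀ * q + 3 * q ^ 2) = 2 * q₀ ^ 5 * q ^ 3 + 4 * q₀ ^ 4 * q ^ 4 + 6 * q₀ ^ 3 * q ^ 5 := by
      ring
    have : (166012 : ℝ) / 3125 * q₀ ^ 8 = 2 * q₀ ^ 5 * ((7 / 5) ^ 3 * q₀ ^ 3) + 4 * q₀ ^ 4 * ((7 / 5) ^ 4 * q₀ ^ 4) +
        6 * q₀ ^ 3 * ((7 / 5) ^ 5 * q₀ ^ 5) := by ring
    rw [e, this]; linarith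
  rw [abs_le]
  constructor <;> linarith

/-- **The per-term second-order difference bound**: for `(3/5)q₀ ≤ q ≤ (7/5)q₀`,
`|G(q) − G(q₀) − G′(q₀)(q − q₀)| ≤ (q − q₀)²·(130·q₀⁻⁸ + 96·q₀⁻⁵)` with `G(q) = V_LJ(√q)`, `G′ = −q₀⁻⁷/2 + q₀⁻⁴/2`. [folklore] -/
theorem tri_lj_T1_remainder_abs_le {q q₀ : ℝ} (hq₀ : 0 < q₀) (hlo : 3 / 5 * q₀ ≤ q) (hhi : q ≤ 7 / 5 * q₀) :
    |lennardJones (Real.sqrt q) - lennardJones (Real.sqrt q₀) - (-(q₀⁻¹ ^ 7) / 2 + q₀⁻¹ ^ 4 / 2) * (q - q₀)| ≤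
      (q - q₀) ^ 2 * (130 * q₀⁻¹ ^ 8 + 96 * q₀⁻¹ ^ 5) := by
  have hq : 0 < q := by linarith
  rw [tri_lj_sqrt_eq hq, tri_lj_sqrt_eq hq₀, tri_lj_T1_identity hq hq₀]
  set N := (q₀ ^ 5 + 2 * q₀ ^ 4 * q + 3 * q₀ ^ 3 * q ^ 2 + 4 * q₀ ^ 2 * q ^ 3 + 5 * q₀ * q ^ 4 + 6 * q ^ 5) -
        2 * q ^ 3 * q₀ ^ 3 * (q₀ ^ 2 + 2 * q₀ * q + 3 * q ^ 2) with hN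
  have hNle : |N| ≤ 225417 / 3125 * q₀ ^ 5 + 166012 / 3125 * q₀ ^ 8 := tri_lj_T1_num_abs_le hq.le hq₀ hhi
  have hden : 0 < 12 * q ^ 6 * q₀ ^ 7 := by positivity
  rw [abs_div, abs_mul, abs_of_nonneg (sq_nonneg _), abs_of_pos hden, div_le_iff₀ hden]
  -- `q⁶ ≥ (3/5)⁶ q₀⁶`
  have hq6 : (3 / 5) ^ 6 * q₀ ^ 6 ≤ q ^ 6 := by
    rw [← mul_pow]; exact pow_le_pow_left₀ (by positivity) hlo 6
  have hd2 : 0 ≤ (q - q₀) ^ 2 := sq_nonneg _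
  -- compare the two sides after clearing the inverse powers
  have hinv : (130 * q₀⁻¹ ^ 8 + 96 * q₀⁻¹ ^ 5) * (12 * q ^ 6 * q₀ ^ 7) = 12 * q ^ 6 * (130 * q₀⁻¹ + 96 * q₀ ^ 2) := by
    have hq₀' : q₀ ≠ 0 := hq₀.ne'
    field_simp
  have key : 225417 / 3125 * q₀ ^ 5 + 166012 / 3125 * q₀ ^ 8 ≤ 12 * q ^ 6 * (130 * q₀⁻¹ + 96 * q₀ ^ 2) := by
    have h1 : 12 * ((3 / 5) ^ 6 * q₀ ^ 6) * (130 * q₀⁻¹ + 96 * q₀ ^ 2) ≤ 12 * q ^ 6 * (130 * q₀⁻¹ + 96 * q₀ ^ 2) := by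
      have : 0 ≤ 130 * q₀⁻¹ + 96 * q₀ ^ 2 := by positivity
      nlinarith [hq6]
    have h2 : 12 * ((3 / 5 : ℝ) ^ 6 * q₀ ^ 6) * (130 * q₀⁻¹ + 96 * q₀ ^ 2) = 12 * (3 / 5) ^ 6 * 130 * q₀ ^ 5 + 12 * (3 / 5) ^ 6 * 96 * q₀ ^ 8 := by
      have hq₀' : q₀ ≠ 0 := hq₀.ne'
      field_simp
    rw [h2] at h1
    have h5 : 0 ≤ q₀ ^ 5 := by positivity
    have h8 : 0 ≤ q₀ ^ 8 := by positivity
    nlinarith [h1, h5, h8]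
  calc (q - q₀) ^ 2 * |N| ≤ (q - q₀) ^ 2 * (225417 / 3125 * q₀ ^ 5 + 166012 / 3125 * q₀ ^ 8) :=
        mul_le_mul_of_nonneg_left hNle hd2
    _ ≤ (q - q₀) ^ 2 * (12 * q ^ 6 * (130 * q₀⁻¹ + 96 * q₀ ^ 2)) := mul_le_mul_of_nonneg_left key hd2
    _ = (q - q₀) ^ 2 * (130 * q₀⁻¹ ^ 8 + 96 * q₀⁻¹ ^ 5) * (12 * q ^ 6 * q₀ ^ 7) := by rw [mul_assoc ((q - q₀) ^ 2), hinv]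

end Summit.AtomisticToContinuum.Crystallization.Theorems.NashClassCertificatesNashNearField

end
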